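import Summits.HubbardSuperconductivity.HubbardSuperconductivity.Theses.ParentFirstSMA
import Literature.MathematicalPhysics.QuantumLattice.HubbardWave0LiebProofs

/-!
# Crux `BoundCoherentDWavePairs` (stmt-HubbardSuperconductivity-10770) — alternative line `split_u12` (crux-strategist s1, 2026-08-17)

ALTERNATIVE LINE, published but deliberately NOT registered by the strategist (`ledger skeleton check`
would replace the live skeleton `Lines/birth.lean` of lead c14; a continuation lead that switches to this
line registers it itself). It is also the PROVED glue of the intended route split
`BoundCoherentDWavePairs ⟸ TwoHoleBindingAtU12 ∧ TwoHoleGroundMeetsDPairAtU12 ∧ DPairBottomResidueAtU12`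
(children + `route edit --split` command in `Lines/split-u12.md`; the gate accepts `--split` only on a
seat's final cycle, so the split is handed to the lead / tenure planner). Census:
`Cruxes/BoundCoherentDWavePairs/STRATEGY-CENSUS.md`.

The cut. The crux is `∃ U ∈ [12, 24], (i) binding ∧ (ii) d-residue`. By the 32-site `t`-`J`
level-ordering data (Leung, PRB 65 (2002) 205101 §2: the `d_{x²−y²}` `K = 0` singlet is the two-hole
ground state only for `J > 0.3t`; finite-momentum `p` states below it for smaller `J`) its plausible
witness set is `≈ {12}` (`J_eff = 4t²/U − 24t⁴/U³ ≈ 0.32t` at `U = 12`). Fix `U = 12` and cut (ii) into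
its two logically different contents, typed spectrally (no `C₄ᵥ` machinery):

* `stub_twoHoleBindingAtU12`          — clause (i) at the witness (energetics; = birth's P at `U = 12`
  up to the landed identity `stub_pairGap_sub_eq_twice_binding`);
* `stub_twoHoleGroundMeetsDPairAtU12` — LEVEL ORDERING (qualitative): some absolute two-hole ground
  state is not orthogonal to the bare `d`-pair `Δ_d ψ₀` — the fragile conjunct, the refuters' target;
* `stub_dPairBottomResidueAtU12`      — RESIDUE at the bottom of the `d`-pair's own spectral support:
  the lowest atom of the spectral measure of `Δ_d ψ₀` in the `(L²−2)`-sector carries weight `≥ z·L²`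
  for EVERY normalised half-filled ground state `ψ₀` — the robust content, what crux #4 (c) consumes
  (symmetry-free form of the refuter fallback (ii′)).

`BoundCoherentDWavePairs_of : stub₁-sig → stub₂-sig → stub₃-sig → BoundCoherentDWavePairs` is PROVED
(variational principle `LiebThm1.groundEnergy_le_re_expect` + the no-weight-below clause; axioms
propext / Classical.choice / Quot.sound); `BoundCoherentDWavePairs_of_stubs : BoundCoherentDWavePairs`
BY NAME modulo the three stubs. `lean check`: rc 0, sorries = 3 = stubs. Probes (strategist folder
`bc/probes3.lean`): `stubᵢ → crux`, `stubᵢ → HubbardSuperconductivity`, `stubᵢ` outright, `crux → stubᵢ`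
FAIL 12/12.
-/

set_option linter.dupNamespace false

namespace Summit.HubbardSuperconductivity.HubbardSuperconductivity.Cruxes.BoundCoherentDWavePairs.SplitU12

open scoped Matrix
open Literature.MathematicalPhysics.QuantumLattice
open Summit.HubbardSuperconductivity.HubbardSuperconductivity.Theses.ParentFirstSMA

/-! ## Stubs (the three children of the intended split, verbatim) -/

/-- **Stub 1 — two-hole binding at `U = 12`** (intended route child `TwoHoleBindingAtU12`): `L`-uniform
`b ≤ Δ_b(L) = 2E(L²−1) − E(L²) − E(L²−2)`, `b > 0`. Why it might fail: `E_b ≈ −0.05t` on 32 sites at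
`J = 0.3t`, shrinking with size; naive FSS unbinds at `J/t = 0.3`.
[cite: doi:10.1103/physrevb.58.13594, §3.2] -/
theorem stub_twoHoleBindingAtU12 :
    ∃ b : ℝ, 0 < b ∧ ∃ L₀ : ℕ, ∀ L : ℕ, L₀ ≤ L → Even L →
      b ≤ 2 * groundEnergyAt (fermionTorusGraph 2 L) 1 12 (L ^ 2 - 1) -
        groundEnergyAt (fermionTorusGraph 2 L) 1 12 (L ^ 2) -
        groundEnergyAt (fermionTorusGraph 2 L) 1 12 (L ^ 2 - 2) := by
  sorry

/-- **Stub 2 — level ordering at `U = 12`** (intended route child `TwoHoleGroundMeetsDPairAtU12`): for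
all large even `L` some absolute two-hole ground state `φ₂` has `⟨φ₂, Δ_d ψ₀⟩ ≠ 0` for some normalised
half-filled ground state `ψ₀`. Why it might fail: `p_(π,π)` / `p_(π,0)` two-hole ground states for
`J < 0.3t` (orthogonal to `Δ_dψ₀` by momentum). [cite: doi:10.1103/physrevb.65.205101, §2] -/
theorem stub_twoHoleGroundMeetsDPairAtU12 :
    ∃ L₀ : ℕ, ∀ (L : ℕ) [NeZero L], L₀ ≤ L → Even L →
      ∃ φ₂ ψ₀ : Fock (Orb (FermionTorus 2 L)),
        IsGroundState (hubbardTorus 2 L 1 12) (L ^ 2 - 2) φ₂ ∧ star φ₂ ⬝ᵥ φ₂ = 1 ∧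
        IsGroundState (hubbardTorus 2 L 1 12) (L ^ 2) ψ₀ ∧ star ψ₀ ⬝ᵥ ψ₀ = 1 ∧
        star φ₂ ⬝ᵥ (pairField dWaveFormFactor L *ᵥ ψ₀) ≠ 0 := by
  sorry

/-- **Stub 3 — residue at the bottom of the `d`-pair's own spectral support at `U = 12`** (intended
route child `DPairBottomResidueAtU12`): `∃ z > 0` such that for all large even `L` and every normalised
half-filled ground state `ψ₀` there are `E : ℝ` and a normalised `(L²−2)`-particle eigenvector `φ` at
`E` with `Δ_d ψ₀ ⊥` every eigenvector of eigenvalue `< E` and `z·L² ≤ |⟨φ, Δ_d ψ₀⟩|²`. Why it might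
fail: unbound/extended lowest `d`-compatible state if binding fails; bare-pair weight `→ 0` with `L`.
[cite: doi:10.1103/physrevb.58.13594, §3.2] -/
theorem stub_dPairBottomResidueAtU12 :
    ∃ z : ℝ, 0 < z ∧ ∃ L₀ : ℕ, ∀ (L : ℕ) [NeZero L], L₀ ≤ L → Even L →
      ∀ ψ₀ : Fock (Orb (FermionTorus 2 L)),
        IsGroundState (hubbardTorus 2 L 1 12) (L ^ 2) ψ₀ → star ψ₀ ⬝ᵥ ψ₀ = 1 →
        ∃ (E : ℝ) (φ : Fock (Orb (FermionTorus 2 L))),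
          IsNParticle (L ^ 2 - 2) φ ∧ star φ ⬝ᵥ φ = 1 ∧
          hubbardTorus 2 L 1 12 *ᵥ φ = (E : ℂ) • φ ∧
          (∀ (μ : ℝ) (v : Fock (Orb (FermionTorus 2 L))),
              hubbardTorus 2 L 1 12 *ᵥ v = (μ : ℂ) • v → μ < E →
                star v ⬝ᵥ (pairField dWaveFormFactor L *ᵥ ψ₀) = 0) ∧
          z * (L : ℝ) ^ 2 ≤ ‖star φ ⬝ᵥ (pairField dWaveFormFactor L *ᵥ ψ₀)‖ ^ 2 := by
  sorry

/-! ## Composition (sorry-free) -/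

/-- The bottom of the `d`-pair's spectral support IS the sector ground energy as soon as some ground
state meets the pair, and then the bottom eigenvector is a ground state: (1) variational principle
`E(L²−2) ≤ ⟨φ, Hφ⟩ = E`; (2) if `E(L²−2) < E` the no-weight-below clause would kill `⟨φ₂, Δ_dψ₀⟩`.
[folklore] -/
theorem isGroundState_of_meets_of_bottom {L : ℕ} [NeZero L]
    {ψ₀ φ₂ φ : Fock (Orb (FermionTorus 2 L))} {E : ℝ}
    (hφ₂ : IsGroundState (hubbardTorus 2 L 1 12) (L ^ 2 - 2) φ₂)
    (hne : star φ₂ ⬝ᵥ (pairField dWaveFormFactor L *ᵥ ψ₀) ≠ 0)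
    (hφN : IsNParticle (L ^ 2 - 2) φ) (hφ1 : star φ ⬝ᵥ φ = 1)
    (hφE : hubbardTorus 2 L 1 12 *ᵥ φ = (E : ℂ) • φ)
    (hbelow : ∀ (μ : ℝ) (v : Fock (Orb (FermionTorus 2 L))),
        hubbardTorus 2 L 1 12 *ᵥ v = (μ : ℂ) • v → μ < E →
          star v ⬝ᵥ (pairField dWaveFormFactor L *ᵥ ψ₀) = 0) :
    IsGroundState (hubbardTorus 2 L 1 12) (L ^ 2 - 2) φ := by
  set H := hubbardTorus 2 L 1 12 with hH
  set E₀ : ℝ := groundEnergy H (L ^ 2 - 2) with hE₀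
  have h1 : E₀ ≤ E := by
    have hle := LiebThm1.groundEnergy_le_re_expect H hφN hφ1
    have hexp : expect H φ = (E : ℂ) := by
      unfold expect
      rw [hφE, dotProduct_smul, hφ1, smul_eq_mul, mul_one]
    rw [hexp] at hle
    simpa using hle
  have h2 : E ≤ E₀ := by
    by_contra hlt
    exact hne (hbelow E₀ φ₂ hφ₂.2.2 (lt_of_not_ge hlt))
  have hEeq : E = E₀ := le_antisymm h2 h1
  refine ⟨hφN, ?_, ?_⟩
  · intro h0
    rw [h0] at hφ1
    simp at hφ1
  · rw [hφE, hEeq]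

/-- **Skeleton theorem: stub₁ → stub₂ → stub₃ → `BoundCoherentDWavePairs`, concluded BY NAME.**
[folklore] -/
theorem BoundCoherentDWavePairs_of
    (hBind : ∃ b : ℝ, 0 < b ∧ ∃ L₀ : ℕ, ∀ L : ℕ, L₀ ≤ L → Even L →
      b ≤ 2 * groundEnergyAt (fermionTorusGraph 2 L) 1 12 (L ^ 2 - 1) -
        groundEnergyAt (fermionTorusGraph 2 L) 1 12 (L ^ 2) -
        groundEnergyAt (fermionTorusGraph 2 L) 1 12 (L ^ 2 - 2))
    (hMeet : ∃ L₀ : ℕ, ∀ (L : ℕ) [NeZero L], L₀ ≤ L → Even L →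
      ∃ φ₂ ψ₀ : Fock (Orb (FermionTorus 2 L)),
        IsGroundState (hubbardTorus 2 L 1 12) (L ^ 2 - 2) φ₂ ∧ star φ₂ ⬝ᵥ φ₂ = 1 ∧
        IsGroundState (hubbardTorus 2 L 1 12) (L ^ 2) ψ₀ ∧ star ψ₀ ⬝ᵥ ψ₀ = 1 ∧
        star φ₂ ⬝ᵥ (pairField dWaveFormFactor L *ᵥ ψ₀) ≠ 0)
    (hRes : ∃ z : ℝ, 0 < z ∧ ∃ L₀ : ℕ, ∀ (L : ℕ) [NeZero L], L₀ ≤ L → Even L →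
      ∀ ψ₀ : Fock (Orb (FermionTorus 2 L)),
        IsGroundState (hubbardTorus 2 L 1 12) (L ^ 2) ψ₀ → star ψ₀ ⬝ᵥ ψ₀ = 1 →
        ∃ (E : ℝ) (φ : Fock (Orb (FermionTorus 2 L))),
          IsNParticle (L ^ 2 - 2) φ ∧ star φ ⬝ᵥ φ = 1 ∧
          hubbardTorus 2 L 1 12 *ᵥ φ = (E : ℂ) • φ ∧
          (∀ (μ : ℝ) (v : Fock (Orb (FermionTorus 2 L))),
              hubbardTorus 2 L 1 12 *ᵥ v = (μ : ℂ) • v → μ < E →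
                star v ⬝ᵥ (pairField dWaveFormFactor L *ᵥ ψ₀) = 0) ∧
          z * (L : ℝ) ^ 2 ≤ ‖star φ ⬝ᵥ (pairField dWaveFormFactor L *ᵥ ψ₀)‖ ^ 2) :
    BoundCoherentDWavePairs := by
  refine ⟨12, le_refl _, by norm_num, hBind, ?_⟩
  obtain ⟨L₂, hL₂⟩ := hMeet
  obtain ⟨z, hz, L₃, hL₃⟩ := hRes
  refine ⟨z, hz, max L₂ L₃, fun L _ hL hLeven => ?_⟩
  obtain ⟨φ₂, ψ₀, hφ₂, -, hψ₀, hψ₀1, hne⟩ := hL₂ L (le_trans (le_max_left _ _) hL) hLeven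
  obtain ⟨E, φ, hφN, hφ1, hφE, hbelow, hres⟩ :=
    hL₃ L (le_trans (le_max_right _ _) hL) hLeven ψ₀ hψ₀ hψ₀1
  exact ⟨φ, ψ₀, isGroundState_of_meets_of_bottom hφ₂ hne hφN hφ1 hφE hbelow, hφ1, hψ₀, hψ₀1, hres⟩

/-- **The crux BY NAME from the named stubs** (its only `sorry`s are the three `stub_*`). [folklore] -/
theorem BoundCoherentDWavePairs_of_stubs : BoundCoherentDWavePairs :=
  BoundCoherentDWavePairs_of stub_twoHoleBindingAtU12 stub_twoHoleGroundMeetsDPairAtU12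
    stub_dPairBottomResidueAtU12

/-! ## Bookkeeping: stub 2 is implied by clause (ii) at the witness (so the cut loses nothing there);
stub 3 is the extra, robust content. -/

/-- Clause (ii) of the crux at a witness with `U = 12` implies the level-ordering stub. [folklore] -/
theorem meets_of_clause_ii
    (h : ∃ z : ℝ, 0 < z ∧ ∃ L₀ : ℕ, ∀ (L : ℕ) [NeZero L], L₀ ≤ L → Even L →
      ∃ φ₂ ψ₀ : Fock (Orb (FermionTorus 2 L)),
        IsGroundState (hubbardTorus 2 L 1 12) (L ^ 2 - 2) φ₂ ∧ star φ₂ ⬝ᵥ φ₂ = 1 ∧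
        IsGroundState (hubbardTorus 2 L 1 12) (L ^ 2) ψ₀ ∧ star ψ₀ ⬝ᵥ ψ₀ = 1 ∧
        z * (L : ℝ) ^ 2 ≤ ‖star φ₂ ⬝ᵥ (pairField dWaveFormFactor L *ᵥ ψ₀)‖ ^ 2) :
    ∃ L₀ : ℕ, ∀ (L : ℕ) [NeZero L], L₀ ≤ L → Even L →
      ∃ φ₂ ψ₀ : Fock (Orb (FermionTorus 2 L)),
        IsGroundState (hubbardTorus 2 L 1 12) (L ^ 2 - 2) φ₂ ∧ star φ₂ ⬝ᵥ φ₂ = 1 ∧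
        IsGroundState (hubbardTorus 2 L 1 12) (L ^ 2) ψ₀ ∧ star ψ₀ ⬝ᵥ ψ₀ = 1 ∧
        star φ₂ ⬝ᵥ (pairField dWaveFormFactor L *ᵥ ψ₀) ≠ 0 := by
  obtain ⟨z, hz, L₀, hL⟩ := h
  refine ⟨max L₀ 1, fun L _ hL' hLeven => ?_⟩
  obtain ⟨φ₂, ψ₀, hφ₂, hφ₂1, hψ₀, hψ₀1, hres⟩ := hL L (le_trans (le_max_left _ _) hL') hLeven
  refine ⟨φ₂, ψ₀, hφ₂, hφ₂1, hψ₀, hψ₀1, fun h0 => ?_⟩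
  have hL1 : (1 : ℝ) ≤ (L : ℝ) := by
    have : 1 ≤ L := le_trans (le_max_right _ _) hL'
    exact_mod_cast this
  have hpos : 0 < z * (L : ℝ) ^ 2 := by positivity
  rw [h0, norm_zero] at hres
  linarith [hres]

end Summit.HubbardSuperconductivity.HubbardSuperconductivity.Cruxes.BoundCoherentDWavePairs.SplitU12
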